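import Summits.QuantumFields.YangMills.Theorems.LangevinControlUVOSLegsFromFemtoAndGapStubAssemblyPlaneExpansion
import Summits.QuantumFields.YangMills.Theorems.BalabanLadderNTMarkovMirrorChiral
import Summits.QuantumFields.YangMills.Theorems.BalabanLadderNTConjugateResponse

/-!
# Route `UniversalDetector`, support item `PlaneLimitExtraction` (stmt-QuantumFields-23251) — the reflected kernel

Ideator seat ym-idea-8 g7 (LINE 4 of rung R2a = `BalabanLadder.NT`, plane-resolved repair).  Route-independent
lattice identities behind the two conclusions of `PlaneLimitExtraction` that the old item `LimitExtraction` could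
not reach from full-kernel tightness: time-reflection invariance of the limit kernel and reflection positivity on
slabs.  On the odd torus the site reflection `Θ` (`cfgReflect`, time `t ↦ −t`) maps the corner action density at
`x` to the REFLECTED-species density at `θx` — the three electric plane fields are read one lattice unit lower
(`Cruxes.NT.MarkovMirror.dens_siteReflect`).  Consequently (all identities exact, every coupling, every torus
`2L+1`):
* `cov_sum_mul_sum` — covariance under `torusE` is bilinear over finite sums of continuous observables;
* `cov_dens_eq_sum_cov_plane_univ` — `Cov_T(dens x, dens y) = Σ_{p,q} Cov_T(plane p x, plane q y)` (orientation
  subtype form);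
* `cov_dens_eq_sum_cov_plane_siteReflect` — `Cov_T(dens x, dens y) = Σ_{p,q} Cov_T(plane p (σ_p θx), plane q (σ_q θy))`
  with `σ_q w = w − e₀` for electric `q = (0, j)` and `σ_q w = w` otherwise (reflection invariance of the torus
  Wilson measure, `Cruxes.NT.ConjugateResponse.torusE_comp_cfgReflect`);
* `cov_dens_mul_dens_cfgReflect_eq_sum` — the MIRROR pairing `Cov_T(dens x, dens y ∘ Θ) = Σ_{p,q} Cov_T(plane p x,
  plane q (σ_q θy))` (the lattice side of slab reflection positivity);
* `cov_plane_translate` — `Cov_T(plane p u, plane q w) = Cov_T(plane p 0, plane q (w − u))`;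
* `cov_dens_zero_eq_sum_siteReflect_shift` — the kernel form: `Cov_T(dens 0, dens z) = Σ_{p,q} Cov6_{pq}(θz + [p]e₀ − [q]e₀)`
  while `Cov_T(dens 0, dens θz) = Σ_{p,q} Cov6_{pq}(θz)`; hence
* `abs_cov_dens_sub_cov_dens_siteReflect_le` — `|Cov_T(dens 0,dens z) − Cov_T(dens 0,dens θz)| ≤ Σ_{p,q} ε_{pq}` whenever
  each plane kernel moves by at most `ε_{pq}` under the unit electric shifts: under the plane-resolved tightness
  (TIGHT6) of the route this is `≤ Σ ω_{pq}(a)` → 0, which is exactly the a-uniform control the repair added.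
No summit, rung or crux is proved here.
-/

set_option autoImplicit false

noncomputable section

open MeasureTheory Filter Topology
open Literature.MathematicalPhysics.QuantumFieldTheory Literature.MathematicalPhysics.QuantumLattice
  Literature.Probability.LatticeModels
open Summit.QuantumFields.YangMills.Cruxes.OSLegsFromFemtoAndGap.DlrCollarTransfer
open Summit.QuantumFields.YangMills.Theorems.OSLegsFromFemtoAndGap (dens_eq_sum_filter_plane)
open Summit.QuantumFields.YangMills.Cruxes.NT.MarkovMirror (dens_siteReflect torusE_sum_mul)
open Summit.QuantumFields.YangMills.Cruxes.NT.ConjugateResponse (torusE_comp_cfgReflect)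

namespace Summit.QuantumFields.YangMills.Cruxes.UniversalDetectorPlaneTight

variable {G : Type} [Group G] [TopologicalSpace G] [IsTopologicalGroup G] [CompactSpace G]
  [MeasurableSpace G] [BorelSpace G] (r : LatticeRep G)

/-! ## Bilinearity of the torus covariance over finite sums -/

/-- Torus expectation of a finite sum (over a `Fintype`) of continuous observables. -/
theorem torusE_sum_univ (β : ℝ) (L : ℕ) {ι : Type} [Fintype ι] (F : ι → LGConfig 4 G → ℝ)
    (hF : ∀ i, Continuous (F i)) :
    torusE G r β L (fun V => ∑ i, F i V) = ∑ i, torusE G r β L (F i) := by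
  have h := torusE_sum_mul G r β L Finset.univ (fun _ => (1 : ℝ)) F (fun i _ => hF i)
  simpa only [one_mul] using h

/-- **Covariance is bilinear over finite sums of continuous observables.** -/
theorem cov_sum_mul_sum (β : ℝ) (L : ℕ) {ι κ : Type} [Fintype ι] [Fintype κ]
    (f : ι → LGConfig 4 G → ℝ) (g : κ → LGConfig 4 G → ℝ) (hf : ∀ i, Continuous (f i))
    (hg : ∀ j, Continuous (g j)) :
    torusE G r β L (fun V => (∑ i, f i V) * ∑ j, g j V) -
        torusE G r β L (fun V => ∑ i, f i V) * torusE G r β L (fun V => ∑ j, g j V) =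
      ∑ i, ∑ j, (torusE G r β L (fun V => f i V * g j V) - torusE G r β L (f i) * torusE G r β L (g j)) := by
  have h1 : torusE G r β L (fun V => (∑ i, f i V) * ∑ j, g j V) =
      ∑ i, ∑ j, torusE G r β L (fun V => f i V * g j V) := by
    calc torusE G r β L (fun V => (∑ i, f i V) * ∑ j, g j V)
        = torusE G r β L (fun V => ∑ i, ∑ j, f i V * g j V) := by
          congr 1; funext V; rw [Finset.sum_mul_sum]
      _ = ∑ i, torusE G r β L (fun V => ∑ j, f i V * g j V) :=
          torusE_sum_univ r β L (fun i V => ∑ j, f i V * g j V)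
            (fun i => continuous_finsetSum _ fun j _ => (hf i).mul (hg j))
      _ = ∑ i, ∑ j, torusE G r β L (fun V => f i V * g j V) :=
          Finset.sum_congr rfl fun i _ => torusE_sum_univ r β L (fun j V => f i V * g j V) (fun j => (hf i).mul (hg j))
  rw [h1, torusE_sum_univ r β L f hf, torusE_sum_univ r β L g hg, Finset.sum_mul_sum]
  simp only [Finset.sum_sub_distrib]

/-! ## The density as a sum of plane fields, plain and reflected -/

/-- The action density at `x` is the sum of the six plane fields at `x` (orientation-subtype form). -/
theorem dens_eq_sum_plane_univ (x : Site 4) (V : LGConfig 4 G) :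
    dens G r x V = ∑ q : {q : Fin 4 × Fin 4 // q.1 < q.2}, plane G r q.1 x V := by
  rw [dens_eq_sum_filter_plane,
    ← Finset.sum_subtype (Finset.univ.filter fun q : Fin 4 × Fin 4 => q.1 < q.2) (fun q => by simp)
      (fun q => plane G r q x V)]

/-- **The density is the reflected-species density of the reflected field at the reflected site**:
`dens x V = Σ_q plane q (σ_q θx) (Θ V)`, electric planes read one unit lower. -/
theorem dens_eq_sum_plane_siteReflect (x : Site 4) (V : LGConfig 4 G) :
    dens G r x V = ∑ q : {q : Fin 4 × Fin 4 // q.1 < q.2},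
      plane G r q.1 (if q.1.1 = 0 then siteReflect x - Pi.single 0 1 else siteReflect x) (cfgReflect V) := by
  have h := dens_siteReflect G r (siteReflect x) V
  rwa [siteReflect_siteReflect] at h

/-- The density of the reflected field: `dens x (Θ V) = Σ_q plane q (σ_q θx) V`. -/
theorem dens_cfgReflect_eq_sum_plane (x : Site 4) (V : LGConfig 4 G) :
    dens G r x (cfgReflect V) = ∑ q : {q : Fin 4 × Fin 4 // q.1 < q.2},
      plane G r q.1 (if q.1.1 = 0 then siteReflect x - Pi.single 0 1 else siteReflect x) V := by
  rw [dens_eq_sum_plane_siteReflect, cfgReflect_cfgReflect]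

/-! ## Covariance expansions -/

/-- **Plain expansion**: `Cov_T(dens x, dens y) = Σ_{p,q} Cov_T(plane p x, plane q y)`. -/
theorem cov_dens_eq_sum_cov_plane_univ (β : ℝ) (L : ℕ) (x y : Site 4) :
    torusE G r β L (fun V => dens G r x V * dens G r y V) - torusE G r β L (dens G r x) * torusE G r β L (dens G r y) =
      ∑ p : {q : Fin 4 × Fin 4 // q.1 < q.2}, ∑ q : {q : Fin 4 × Fin 4 // q.1 < q.2},
        (torusE G r β L (fun V => plane G r p.1 x V * plane G r q.1 y V) -
          torusE G r β L (plane G r p.1 x) * torusE G r β L (plane G r q.1 y)) := by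
  have hx : dens G r x = fun V => ∑ p : {q : Fin 4 × Fin 4 // q.1 < q.2}, plane G r p.1 x V :=
    funext fun V => dens_eq_sum_plane_univ r x V
  have hy : dens G r y = fun V => ∑ q : {q : Fin 4 × Fin 4 // q.1 < q.2}, plane G r q.1 y V :=
    funext fun V => dens_eq_sum_plane_univ r y V
  rw [hx, hy]
  exact cov_sum_mul_sum r β L _ _ (fun p => continuous_plane r p.1 x) (fun q => continuous_plane r q.1 y)

/-- **Reflected expansion**: `Cov_T(dens x, dens y) = Σ_{p,q} Cov_T(plane p (σ_p θx), plane q (σ_q θy))` — reflection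
invariance of the torus Wilson measure moves `Θ` off the observables. -/
theorem cov_dens_eq_sum_cov_plane_siteReflect (β : ℝ) (L : ℕ) (x y : Site 4) :
    torusE G r β L (fun V => dens G r x V * dens G r y V) - torusE G r β L (dens G r x) * torusE G r β L (dens G r y) =
      ∑ p : {q : Fin 4 × Fin 4 // q.1 < q.2}, ∑ q : {q : Fin 4 × Fin 4 // q.1 < q.2},
        (torusE G r β L (fun V =>
            plane G r p.1 (if p.1.1 = 0 then siteReflect x - Pi.single 0 1 else siteReflect x) V *
              plane G r q.1 (if q.1.1 = 0 then siteReflect y - Pi.single 0 1 else siteReflect y) V) -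
          torusE G r β L (plane G r p.1 (if p.1.1 = 0 then siteReflect x - Pi.single 0 1 else siteReflect x)) *
            torusE G r β L (plane G r q.1 (if q.1.1 = 0 then siteReflect y - Pi.single 0 1 else siteReflect y))) := by
  set f : {q : Fin 4 × Fin 4 // q.1 < q.2} → LGConfig 4 G → ℝ :=
    fun p => plane G r p.1 (if p.1.1 = 0 then siteReflect x - Pi.single 0 1 else siteReflect x) with hf
  set g : {q : Fin 4 × Fin 4 // q.1 < q.2} → LGConfig 4 G → ℝ :=
    fun q => plane G r q.1 (if q.1.1 = 0 then siteReflect y - Pi.single 0 1 else siteReflect y) with hg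
  have hx : dens G r x = fun V => ∑ p, f p (cfgReflect V) :=
    funext fun V => dens_eq_sum_plane_siteReflect r x V
  have hy : dens G r y = fun V => ∑ q, g q (cfgReflect V) :=
    funext fun V => dens_eq_sum_plane_siteReflect r y V
  have hxy : (fun V => dens G r x V * dens G r y V) =
      fun V => (∑ p, f p (cfgReflect V)) * ∑ q, g q (cfgReflect V) := by
    funext V; rw [hx, hy]
  rw [hxy, torusE_comp_cfgReflect G r β L (fun W => (∑ p, f p W) * ∑ q, g q W), hx,
    torusE_comp_cfgReflect G r β L (fun W => ∑ p, f p W), hy, torusE_comp_cfgReflect G r β L (fun W => ∑ q, g q W)]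
  exact cov_sum_mul_sum r β L f g (fun p => continuous_plane r _ _) (fun q => continuous_plane r _ _)

/-- **Mirror pairing**: `Cov_T(dens x, dens y ∘ Θ) = Σ_{p,q} Cov_T(plane p x, plane q (σ_q θy))` (and `E_T[dens y ∘ Θ] =
E_T[dens y]`).  This is the lattice side of slab reflection positivity for density-smeared observables. -/
theorem cov_dens_mul_dens_cfgReflect_eq_sum (β : ℝ) (L : ℕ) (x y : Site 4) :
    torusE G r β L (fun V => dens G r x V * dens G r y (cfgReflect V)) -
        torusE G r β L (dens G r x) * torusE G r β L (dens G r y) =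
      ∑ p : {q : Fin 4 × Fin 4 // q.1 < q.2}, ∑ q : {q : Fin 4 × Fin 4 // q.1 < q.2},
        (torusE G r β L (fun V => plane G r p.1 x V *
            plane G r q.1 (if q.1.1 = 0 then siteReflect y - Pi.single 0 1 else siteReflect y) V) -
          torusE G r β L (plane G r p.1 x) *
            torusE G r β L (plane G r q.1 (if q.1.1 = 0 then siteReflect y - Pi.single 0 1 else siteReflect y))) := by
  set g : {q : Fin 4 × Fin 4 // q.1 < q.2} → LGConfig 4 G → ℝ :=
    fun q => plane G r q.1 (if q.1.1 = 0 then siteReflect y - Pi.single 0 1 else siteReflect y) with hg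
  have hx : dens G r x = fun V => ∑ p : {q : Fin 4 × Fin 4 // q.1 < q.2}, plane G r p.1 x V :=
    funext fun V => dens_eq_sum_plane_univ r x V
  have hyr : (fun V => dens G r y (cfgReflect V)) = fun V => ∑ q, g q V :=
    funext fun V => dens_cfgReflect_eq_sum_plane r y V
  have hy : torusE G r β L (dens G r y) = torusE G r β L (fun V => ∑ q, g q V) := by
    rw [← hyr, torusE_comp_cfgReflect G r β L]
  have hxy : (fun V => dens G r x V * dens G r y (cfgReflect V)) =
      fun V => (∑ p : {q : Fin 4 × Fin 4 // q.1 < q.2}, plane G r p.1 x V) * ∑ q, g q V := by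
    funext V; rw [dens_eq_sum_plane_univ, dens_cfgReflect_eq_sum_plane]
  rw [hxy, hy, hx]
  exact cov_sum_mul_sum r β L _ g (fun p => continuous_plane r _ _) (fun q => continuous_plane r _ _)

/-! ## Translation to kernel form -/

/-- Torus expectations are translation invariant (plain-function form of `torusE_comp_configShift`). -/
theorem torusE_configShift_neg (β : ℝ) (L : ℕ) (F : LGConfig 4 G → ℝ) (u : Site 4) :
    torusE G r β L (fun V => F (configShift (-u) V)) = torusE G r β L F := by
  have hF : F ∘ configShift (-(0 : Site 4)) = F := by
    funext V
    simp only [Function.comp_apply, neg_zero]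
    congr 1
    funext e
    simp [Literature.MathematicalPhysics.QuantumLattice.configShift_apply]
  rw [show (fun V => F (configShift (-u) V)) = F ∘ configShift (-u) from rfl,
    Summit.QuantumFields.YangMills.Theorems.OSLegsFromFemtoAndGap.torusE_comp_configShift r β L F u,
    ← Summit.QuantumFields.YangMills.Theorems.OSLegsFromFemtoAndGap.torusE_comp_configShift r β L F 0, hF]

omit [IsTopologicalGroup G] [CompactSpace G] [BorelSpace G] in
/-- A plane field at `w` is the plane field at `w − u` of the configuration translated by `−u`. -/
theorem plane_configShift_neg (q : Fin 4 × Fin 4) (u w : Site 4) (V : LGConfig 4 G) :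
    plane G r q (w - u) (configShift (-u) V) = plane G r q w V := by
  unfold plane
  congr 1
  funext e
  simp only [Literature.MathematicalPhysics.QuantumLattice.configShift_apply]
  congr 2
  ext i
  simp only [Pi.sub_apply, Pi.neg_apply]
  ring

/-- **Translation of plane covariances**: `Cov_T(plane p u, plane q w) = Cov_T(plane p 0, plane q (w − u))`. -/
theorem cov_plane_translate (β : ℝ) (L : ℕ) (p q : Fin 4 × Fin 4) (u w : Site 4) :
    torusE G r β L (fun V => plane G r p u V * plane G r q w V) - torusE G r β L (plane G r p u) * torusE G r β L (plane G r q w) =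
      torusE G r β L (fun V => plane G r p 0 V * plane G r q (w - u) V) -
        torusE G r β L (plane G r p 0) * torusE G r β L (plane G r q (w - u)) := by
  have e2 : ∀ V, plane G r p u V = plane G r p 0 (configShift (-u) V) := fun V => by
    have h := plane_configShift_neg r p u u V
    rw [sub_self] at h
    exact h.symm
  have e3 : ∀ V, plane G r q w V = plane G r q (w - u) (configShift (-u) V) := fun V =>
    (plane_configShift_neg r q u w V).symm
  have h1 : (fun V => plane G r p u V * plane G r q w V) =
      fun V => plane G r p 0 (configShift (-u) V) * plane G r q (w - u) (configShift (-u) V) := by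
    funext V; rw [e2, e3]
  have h2 : plane G r p u = fun V => plane G r p 0 (configShift (-u) V) := funext e2
  have h3 : plane G r q w = fun V => plane G r q (w - u) (configShift (-u) V) := funext e3
  rw [h1, torusE_configShift_neg r β L (fun W => plane G r p 0 W * plane G r q (w - u) W) u, h2,
    torusE_configShift_neg r β L (plane G r p 0) u, h3, torusE_configShift_neg r β L (plane G r q (w - u)) u]

/-- **Kernel form of the reflected expansion at the origin.**  With `Cov6_{pq}(z) := Cov_T(plane p 0, plane q z)`:
`Cov_T(dens 0, dens z) = Σ_{p,q} Cov6_{pq}(θz + [p electric]e₀ − [q electric]e₀)`. -/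
theorem cov_dens_zero_eq_sum_siteReflect_shift (β : ℝ) (L : ℕ) (z : Site 4) :
    torusE G r β L (fun V => dens G r 0 V * dens G r z V) - torusE G r β L (dens G r 0) * torusE G r β L (dens G r z) =
      ∑ p : {q : Fin 4 × Fin 4 // q.1 < q.2}, ∑ q : {q : Fin 4 × Fin 4 // q.1 < q.2},
        (torusE G r β L (fun V => plane G r p.1 0 V *
            plane G r q.1 (siteReflect z + ((if p.1.1 = 0 then Pi.single 0 1 else 0) -
              (if q.1.1 = 0 then Pi.single 0 1 else 0))) V) -
          torusE G r β L (plane G r p.1 0) *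
            torusE G r β L (plane G r q.1 (siteReflect z + ((if p.1.1 = 0 then Pi.single 0 1 else 0) -
              (if q.1.1 = 0 then Pi.single 0 1 else 0))))) := by
  rw [cov_dens_eq_sum_cov_plane_siteReflect]
  refine Finset.sum_congr rfl fun p _ => Finset.sum_congr rfl fun q _ => ?_
  rw [cov_plane_translate]
  have hs0 : siteReflect (0 : Site 4) = 0 := by
    funext k; by_cases hk : k = 0 <;> simp [siteReflect, hk]
  have harg : (if q.1.1 = 0 then siteReflect z - Pi.single 0 1 else siteReflect z) -
      (if p.1.1 = 0 then siteReflect (0 : Site 4) - Pi.single 0 1 else siteReflect 0) =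
      siteReflect z + ((if p.1.1 = 0 then Pi.single 0 1 else 0) - (if q.1.1 = 0 then Pi.single 0 1 else 0)) := by
    rw [hs0]; split_ifs <;> abel
  rw [harg]

/-- **Kernel form of the plain expansion at the origin**: `Cov_T(dens 0, dens w) = Σ_{p,q} Cov6_{pq}(w)`. -/
theorem cov_dens_zero_eq_sum (β : ℝ) (L : ℕ) (w : Site 4) :
    torusE G r β L (fun V => dens G r 0 V * dens G r w V) - torusE G r β L (dens G r 0) * torusE G r β L (dens G r w) =
      ∑ p : {q : Fin 4 × Fin 4 // q.1 < q.2}, ∑ q : {q : Fin 4 × Fin 4 // q.1 < q.2},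
        (torusE G r β L (fun V => plane G r p.1 0 V * plane G r q.1 w V) -
          torusE G r β L (plane G r p.1 0) * torusE G r β L (plane G r q.1 w)) :=
  cov_dens_eq_sum_cov_plane_univ r β L 0 w

/-- **Approximate reflection invariance of the density kernel from plane-kernel continuity.**  If every plane
kernel `Cov6_{pq}` moves by at most `ε p q` between `θz` and the electrically shifted point `θz + [p]e₀ − [q]e₀`,
then `|Cov_T(dens 0, dens z) − Cov_T(dens 0, dens θz)| ≤ Σ_{p,q} ε p q`.  Under the route's plane-resolved
tightness (TIGHT6) at fixed physical separation the right-hand side is `≤ Σ ω_{pq}(a) → 0`. -/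
theorem abs_cov_dens_sub_cov_dens_siteReflect_le (β : ℝ) (L : ℕ) (z : Site 4)
    (ε : {q : Fin 4 × Fin 4 // q.1 < q.2} → {q : Fin 4 × Fin 4 // q.1 < q.2} → ℝ)
    (hε : ∀ p q : {q : Fin 4 × Fin 4 // q.1 < q.2},
      |(torusE G r β L (fun V => plane G r p.1 0 V *
            plane G r q.1 (siteReflect z + ((if p.1.1 = 0 then Pi.single 0 1 else 0) -
              (if q.1.1 = 0 then Pi.single 0 1 else 0))) V) -
          torusE G r β L (plane G r p.1 0) *
            torusE G r β L (plane G r q.1 (siteReflect z + ((if p.1.1 = 0 then Pi.single 0 1 else 0) -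
              (if q.1.1 = 0 then Pi.single 0 1 else 0))))) -
        (torusE G r β L (fun V => plane G r p.1 0 V * plane G r q.1 (siteReflect z) V) -
          torusE G r β L (plane G r p.1 0) * torusE G r β L (plane G r q.1 (siteReflect z)))| ≤ ε p q) :
    |(torusE G r β L (fun V => dens G r 0 V * dens G r z V) - torusE G r β L (dens G r 0) * torusE G r β L (dens G r z)) -
      (torusE G r β L (fun V => dens G r 0 V * dens G r (siteReflect z) V) -
        torusE G r β L (dens G r 0) * torusE G r β L (dens G r (siteReflect z)))| ≤ ∑ p, ∑ q, ε p q := by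
  rw [cov_dens_zero_eq_sum_siteReflect_shift, cov_dens_zero_eq_sum r β L (siteReflect z), ← Finset.sum_sub_distrib]
  refine (Finset.abs_sum_le_sum_abs _ _).trans (Finset.sum_le_sum fun p _ => ?_)
  rw [← Finset.sum_sub_distrib]
  exact (Finset.abs_sum_le_sum_abs _ _).trans (Finset.sum_le_sum fun q _ => hε p q)

end Summit.QuantumFields.YangMills.Cruxes.UniversalDetectorPlaneTight

end
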